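import Summits.HubbardSuperconductivity.HubbardSuperconductivity.Theorems.AnisotropyChordHeatKernelRate
import Literature.LinearAlgebra.Matrix.HermitianCfcDiagonalForm

/-!
# Route `AnisotropyChord`: the heat-kernel rate of a vector in an invariant subspace is the GROUND
# energy it sees — lemma R of the theory seat's PORT-SPEC §71 (S5) in its stated form, PROVED

`H` Hermitian, `K` an `H`-invariant subspace with `H ≥ E` on `K`, `w ∈ K` an eigenvector with eigenvalue
`E`, `v ∈ K` with `⟨w, v⟩ ≠ 0`.  Then `Re⟨v, e^{−tH} v⟩ > 0` and `−t⁻¹ log Re⟨v, e^{−tH} v⟩ → E`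
(`heatKernelRate_of_groundOverlap` = the theory seat's `HeatKernelRateOfGroundOverlap`, Sketch6
§EnergyConvexity, verbatim as a theorem).  With `K = spinZSector`, `v = 𝟙_W`, `w = ψ_W` (Perron–Frobenius)
it identifies the rates in `XXZSectorHeatAmplitudeLogConcave` with `lowestEnergyInSector`, so that
`midpoint_convex_of_logConcave_rates` (`…EnergyConvexityDefs`) turns heat-amplitude log-concavity into
E-CONV.

Proof: by `heatKernel_rate` it suffices that `E` is the least eigenvalue carrying weight of `v`:
(i) `⟨w,v⟩ = Σ_k conj(z_k) y_k` (`z = U⋆w`, `y = U⋆v`) and `z` is supported on `{λ_k = E}`, so some `y_k ≠ 0`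
has `λ_k = E`; (ii) the spectral projection of `v` below `E` is `p(H) v ∈ K` for an interpolating
polynomial `p` (`cfc_eq_aeval_of_eval_eq`), and `H ≥ E` on `K` forces it to vanish.
O. Bratteli, D. Robinson II §5.3.1.  No definition is introduced.
-/

set_option linter.dupNamespace false

noncomputable section

namespace Summit.HubbardSuperconductivity.HubbardSuperconductivity.Theorems.AnisotropyChord

open Matrix Complex Finset Filter Topology Polynomial
open scoped ComplexOrder
open Literature.MathematicalPhysics.QuantumLattice
open Literature.LinearAlgebra.Matrix (exists_polynomial_eval_eq cfc_eq_aeval_of_eval_eq)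

variable {ι : Type*} [Fintype ι] [DecidableEq ι]

/-- Quadratic forms of `U diag(d) U⋆` in eigen-coordinates:
`⟨x, U diag(d) U⋆ x⟩ = Σ_k d_k |(U⋆x)_k|²`. [folklore] -/
theorem form_conj_diagonal {H : Matrix ι ι ℂ} (hH : H.IsHermitian) (d : ι → ℂ) (x : ι → ℂ) :
    star x ⬝ᵥ (((hH.eigenvectorUnitary : Matrix ι ι ℂ) * diagonal d *
      star (hH.eigenvectorUnitary : Matrix ι ι ℂ)) *ᵥ x) =
      ∑ k, d k * ((‖(star (hH.eigenvectorUnitary : Matrix ι ι ℂ) *ᵥ x) k‖ ^ 2 : ℝ) : ℂ) := by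
  set U : Matrix ι ι ℂ := (hH.eigenvectorUnitary : Matrix ι ι ℂ) with hU
  set y : ι → ℂ := star U *ᵥ x with hy
  rw [← mulVec_mulVec, ← mulVec_mulVec, ← hy, dotProduct_mulVec]
  have hvU : star x ᵥ* U = star y := by
    rw [hy, star_mulVec, star_eq_conjTranspose, conjTranspose_conjTranspose]
  rw [hvU, dotProduct]
  refine Finset.sum_congr rfl fun k _ => ?_
  rw [mulVec_diagonal, Pi.star_apply]
  have hn : star (y k) * y k = ((‖y k‖ ^ 2 : ℝ) : ℂ) := by
    rw [Complex.star_def, Complex.conj_mul', Complex.ofReal_pow]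
  rw [← hn]
  ring

/-- Inner products in eigen-coordinates: `⟨w, v⟩ = Σ_k conj((U⋆w)_k) (U⋆v)_k`. [folklore] -/
theorem star_dotProduct_eq_sum_eigenCoord {H : Matrix ι ι ℂ} (hH : H.IsHermitian) (w v : ι → ℂ) :
    star w ⬝ᵥ v = ∑ k, star ((star (hH.eigenvectorUnitary : Matrix ι ι ℂ) *ᵥ w) k) *
      (star (hH.eigenvectorUnitary : Matrix ι ι ℂ) *ᵥ v) k := by
  set U : Matrix ι ι ℂ := (hH.eigenvectorUnitary : Matrix ι ι ℂ) with hU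
  have hUU : U * star U = 1 := Unitary.coe_mul_star_self _
  conv_lhs => rw [show v = U *ᵥ (star U *ᵥ v) by rw [mulVec_mulVec, hUU, one_mulVec]]
  rw [dotProduct_mulVec, show star w ᵥ* U = star (star U *ᵥ w) by
    rw [star_mulVec, star_eq_conjTranspose, conjTranspose_conjTranspose], dotProduct]
  rfl

/-- Eigen-coordinates of an eigenvector are supported on the eigenvalue: if `H w = E w` then
`(λ_k − E) (U⋆w)_k = 0`. [folklore] -/
theorem eigenCoord_of_eigenvector {H : Matrix ι ι ℂ} (hH : H.IsHermitian) {w : ι → ℂ} {E : ℝ}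
    (hw : H *ᵥ w = (E : ℂ) • w) (k : ι) :
    ((hH.eigenvalues k : ℂ) - E) * (star (hH.eigenvectorUnitary : Matrix ι ι ℂ) *ᵥ w) k = 0 := by
  set U : Matrix ι ι ℂ := (hH.eigenvectorUnitary : Matrix ι ι ℂ) with hU
  have hspec : H = U * diagonal (fun j => ((hH.eigenvalues j : ℝ) : ℂ)) * star U := by
    conv_lhs => rw [hH.spectral_theorem, Unitary.conjStarAlgAut_apply]
    rfl
  have hUU' : star U * U = 1 := Unitary.coe_star_mul_self _
  have hUH : star U * H = diagonal (fun j => ((hH.eigenvalues j : ℝ) : ℂ)) * star U := by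
    have e := congrArg (fun M : Matrix ι ι ℂ => star U * M) hspec
    rw [e, ← Matrix.mul_assoc, ← Matrix.mul_assoc, hUU', Matrix.one_mul]
  have h1 : star U *ᵥ (H *ᵥ w) = diagonal (fun j => ((hH.eigenvalues j : ℝ) : ℂ)) *ᵥ (star U *ᵥ w) := by
    rw [mulVec_mulVec, hUH, ← mulVec_mulVec]
  rw [hw, mulVec_smul] at h1
  have h2 := congrFun h1 k
  simp only [Pi.smul_apply, smul_eq_mul, mulVec_diagonal] at h2
  linear_combination -h2

/-- An `H`-invariant subspace is invariant under every polynomial in `H`. [folklore] -/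
theorem aeval_mulVec_mem {H : Matrix ι ι ℂ} (K : Submodule ℂ (ι → ℂ)) (hK : ∀ x ∈ K, H *ᵥ x ∈ K)
    (p : ℝ[X]) {v : ι → ℂ} (hv : v ∈ K) : (aeval H p : Matrix ι ι ℂ) *ᵥ v ∈ K := by
  induction p using Polynomial.induction_on' with
  | add p q hp hq =>
    rw [map_add, add_mulVec]
    exact K.add_mem hp hq
  | monomial n c =>
    rw [aeval_monomial]
    have hpow : ∀ m : ℕ, (H ^ m) *ᵥ v ∈ K := by
      intro m
      induction m with
      | zero => simpa using hv
      | succ m ih => rw [pow_succ', ← mulVec_mulVec]; exact hK _ ih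
    have hc : (algebraMap ℝ (Matrix ι ι ℂ) c) = ((c : ℂ)) • (1 : Matrix ι ι ℂ) := by
      ext i j
      simp [Matrix.algebraMap_matrix_apply, Matrix.one_apply, Matrix.smul_apply]
    rw [hc, ← mulVec_mulVec, smul_mulVec, one_mulVec]
    exact K.smul_mem _ (hpow n)

/-- **LEMMA R (theory seat PORT-SPEC §71, as stated: `HeatKernelRateOfGroundOverlap`), PROVED.**
`H` Hermitian, `K` an `H`-invariant subspace on which `H ≥ E`, `w ∈ K` a nonzero eigenvector with
eigenvalue `E`, `v ∈ K` with `⟨w, v⟩ ≠ 0`: the heat-kernel amplitude `Re⟨v, e^{−tH} v⟩` is positive for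
`t ≥ 0` and `−t⁻¹ log Re⟨v, e^{−tH} v⟩ → E`.  Bratteli–Robinson II §5.3.1. [folklore] -/
theorem heatKernelRate_of_groundOverlap (H : Matrix ι ι ℂ) (hH : H.IsHermitian)
    (K : Submodule ℂ (ι → ℂ)) (hK : ∀ x ∈ K, H *ᵥ x ∈ K)
    (E : ℝ) (hE : ∀ x ∈ K, E * (star x ⬝ᵥ x).re ≤ (star x ⬝ᵥ H *ᵥ x).re)
    (w : ι → ℂ) (_hwK : w ∈ K) (_hw0 : w ≠ 0) (hHw : H *ᵥ w = (E : ℂ) • w)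
    (v : ι → ℂ) (hvK : v ∈ K) (hwv : star w ⬝ᵥ v ≠ 0) :
    (∀ t : ℝ, 0 ≤ t → 0 < (star v ⬝ᵥ (NormedSpace.exp (-(t : ℂ) • H)) *ᵥ v).re) ∧
    Tendsto (fun t : ℝ => -Real.log ((star v ⬝ᵥ (NormedSpace.exp (-(t : ℂ) • H)) *ᵥ v).re) / t)
      atTop (𝓝 E) := by
  have hv0 : v ≠ 0 := by
    intro h; rw [h, dotProduct_zero] at hwv; exact hwv rfl
  set U : Matrix ι ι ℂ := (hH.eigenvectorUnitary : Matrix ι ι ℂ) with hU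
  set y : ι → ℂ := star U *ᵥ v with hy
  set z : ι → ℂ := star U *ᵥ w with hz
  refine ⟨fun t _ => heatKernel_form_pos hH hv0 t, heatKernel_rate hH v ?_ ?_⟩
  · -- (ii) no weight below `E`
    intro k hk
    by_contra hlt
    push Not at hlt
    -- the spectral projection below `E`, as a polynomial in `H`
    set g : ℝ → ℝ := fun s => if s < E then 1 else 0 with hg
    obtain ⟨p, hp⟩ := exists_polynomial_eval_eq (spectrum ℝ H) (Matrix.finite_real_spectrum) g
    have hcfc : cfc g H = aeval H p := cfc_eq_aeval_of_eval_eq hH g p hp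
    have hdiag : cfc g H = U * diagonal (fun j => ((g (hH.eigenvalues j) : ℝ) : ℂ)) * star U := by
      rw [hH.cfc_eq, IsHermitian.cfc, Unitary.conjStarAlgAut_apply]
      rfl
    set x : ι → ℂ := cfc g H *ᵥ v with hx
    have hxK : x ∈ K := by rw [hx, hcfc]; exact aeval_mulVec_mem K hK p hvK
    -- eigen-coordinates of `x`
    have hUU' : star U * U = 1 := Unitary.coe_star_mul_self _
    have hyx : star U *ᵥ x = fun j => ((g (hH.eigenvalues j) : ℝ) : ℂ) * y j := by
      rw [hx, hdiag, mulVec_mulVec, ← Matrix.mul_assoc, ← Matrix.mul_assoc, hUU', Matrix.one_mul,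
        ← mulVec_mulVec, ← hy]
      funext j
      rw [mulVec_diagonal]
    -- the two quadratic forms
    have hspec : H = U * diagonal (fun j => ((hH.eigenvalues j : ℝ) : ℂ)) * star U := by
      conv_lhs => rw [hH.spectral_theorem, Unitary.conjStarAlgAut_apply]
      rfl
    have hform : (star x ⬝ᵥ H *ᵥ x).re = ∑ j, hH.eigenvalues j * ((g (hH.eigenvalues j)) ^ 2 * ‖y j‖ ^ 2) := by
      have e : star x ⬝ᵥ H *ᵥ x =
          star x ⬝ᵥ ((U * diagonal (fun j => ((hH.eigenvalues j : ℝ) : ℂ)) * star U) *ᵥ x) := by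
        rw [← hspec]
      rw [e, form_conj_diagonal hH, Complex.re_sum]
      refine Finset.sum_congr rfl fun j _ => ?_
      rw [hyx]
      simp only [norm_mul, Complex.norm_real, Real.norm_eq_abs, mul_pow, sq_abs]
      rw [← Complex.ofReal_mul, Complex.ofReal_re]
    have hnorm : (star x ⬝ᵥ x).re = ∑ j, (g (hH.eigenvalues j)) ^ 2 * ‖y j‖ ^ 2 := by
      have h1 : star x ⬝ᵥ x = star x ⬝ᵥ ((U * diagonal (fun _ => (1 : ℂ)) * star U) *ᵥ x) := by
        rw [diagonal_one, Matrix.mul_one, show U * star U = 1 from Unitary.coe_mul_star_self _, one_mulVec]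
      rw [h1, form_conj_diagonal hH, Complex.re_sum]
      refine Finset.sum_congr rfl fun j _ => ?_
      rw [hyx, one_mul, Complex.ofReal_re, norm_mul, Complex.norm_real, Real.norm_eq_abs, mul_pow, sq_abs]
    have key := hE x hxK
    rw [hform, hnorm, Finset.mul_sum] at key
    -- termwise `λ_j g_j² |y_j|² ≤ E g_j² |y_j|²`, strictly at `k`
    have hterm : ∀ j, hH.eigenvalues j * ((g (hH.eigenvalues j)) ^ 2 * ‖y j‖ ^ 2) ≤
        E * ((g (hH.eigenvalues j)) ^ 2 * ‖y j‖ ^ 2) := by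
      intro j
      by_cases hj : hH.eigenvalues j < E
      · exact mul_le_mul_of_nonneg_right hj.le (by positivity)
      · simp [hg, hj]
    have hk' : hH.eigenvalues k * ((g (hH.eigenvalues k)) ^ 2 * ‖y k‖ ^ 2) <
        E * ((g (hH.eigenvalues k)) ^ 2 * ‖y k‖ ^ 2) := by
      have hgk : g (hH.eigenvalues k) = 1 := by simp [hg, hlt]
      rw [hgk, one_pow, one_mul]
      have hyk : 0 < ‖y k‖ ^ 2 := by
        have : y k ≠ 0 := hk
        positivity
      exact mul_lt_mul_of_pos_right hlt hyk
    have hlt' : ∑ j, hH.eigenvalues j * ((g (hH.eigenvalues j)) ^ 2 * ‖y j‖ ^ 2) <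
        ∑ j, E * ((g (hH.eigenvalues j)) ^ 2 * ‖y j‖ ^ 2) :=
      Finset.sum_lt_sum (fun j _ => hterm j) ⟨k, Finset.mem_univ _, hk'⟩
    linarith
  · -- (i) `E` is attained on the support of `v`
    have hsum : star w ⬝ᵥ v = ∑ k, star (z k) * y k := star_dotProduct_eq_sum_eigenCoord hH w v
    obtain ⟨k, -, hk⟩ : ∃ k ∈ (Finset.univ : Finset ι), star (z k) * y k ≠ 0 := by
      by_contra h
      push Not at h
      exact hwv (by rw [hsum]; exact Finset.sum_eq_zero h)
    have hzk : z k ≠ 0 := fun h0 => hk (by rw [h0, star_zero, zero_mul])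
    have hyk : y k ≠ 0 := fun h0 => hk (by rw [h0, mul_zero])
    refine ⟨k, hyk, ?_⟩
    have h := eigenCoord_of_eigenvector hH hHw k
    rcases mul_eq_zero.1 h with h1 | h1
    · exact_mod_cast (sub_eq_zero.1 h1)
    · exact absurd h1 hzk

end Summit.HubbardSuperconductivity.HubbardSuperconductivity.Theorems.AnisotropyChord
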